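import Summits.MatrixMultiplication.OmegaCensus.ThreeSetLineModFourSlice
import Summits.MatrixMultiplication.OmegaCensus.ThreeSetLineInverseCertificate
import HarnessLib

/-!
# The bit-sliced MOD-4 FILTER, II: semantics of the sliced digits and vectors

ω-census `pub-omega`, family (b3), seat pub-omega-group gen 42.  Framing: lottery ticket; floor = certified bounds/negative
ranges.  VALUE: a kernel TOOL for the three-set cube cells `(4, d, e)@p²` (`ThreeSetZpCells4Core`); NOT progress on ω.
For a datum index `k`, `val2 k (lo, hi) ∈ ZMod 4` is the digit carried by bit `k`; `toF p k f : ZMod p → ZMod 4` is the function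
carried by a sliced vector.  Lemmas: the gadgets `add2 / neg2 / sub2 / mul2 / smul2` compute `+ / − / · / c·` in `ZMod 4`
slice-wise; `conv2` is the cyclic convolution `LineMod.cconv`; `psl / qsl` are the symbols `LineMod.psym / qsym` of `lineMat3`
when the sliced data carry `F mod 4`; `hatv`, `vadd / vsub / vneg`, `ppl`, `vsumTo`, `holeVec` likewise.
-/

namespace Summit.MatrixMultiplication.OmegaCensus

/-! # Semantics of the sliced gadgets (bit `k` of every slice) -/

namespace LineMod

open Finset

/-! ## Digits -/

/-- The value of bit `k` of a slice, in `ZMod 4`. [folklore] -/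
def bv (k n : ℕ) : ZMod 4 := if n.testBit k then 1 else 0

/-- The `ℤ/4`-digit of datum `k` in a sliced digit. [folklore] -/
def val2 (k : ℕ) (a : S2) : ZMod 4 := bv k a.1 + 2 * bv k a.2

/-- `val2` of the zero digit. [folklore] -/
@[simp] theorem val2_zero (k : ℕ) : val2 k (0, 0) = 0 := by simp [val2, bv]

/-- `add2` adds. [folklore] -/
theorem val2_add2 (k : ℕ) (a b : S2) : val2 k (add2 a b) = val2 k a + val2 k b := by
  unfold val2 add2 bv
  simp only [Nat.testBit_xor, Nat.testBit_land]
  cases a.1.testBit k <;> cases a.2.testBit k <;> cases b.1.testBit k <;> cases b.2.testBit k <;> decide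

/-- `neg2` negates. [folklore] -/
theorem val2_neg2 (k : ℕ) (a : S2) : val2 k (neg2 a) = -val2 k a := by
  unfold val2 neg2 bv
  simp only [Nat.testBit_xor]
  cases a.1.testBit k <;> cases a.2.testBit k <;> decide

/-- `sub2` subtracts. [folklore] -/
theorem val2_sub2 (k : ℕ) (a b : S2) : val2 k (sub2 a b) = val2 k a - val2 k b := by
  rw [sub2, val2_add2, val2_neg2, sub_eq_add_neg]

/-- `mul2` multiplies. [folklore] -/
theorem val2_mul2 (k : ℕ) (a b : S2) : val2 k (mul2 a b) = val2 k a * val2 k b := by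
  unfold val2 mul2 bv
  simp only [Nat.testBit_xor, Nat.testBit_land]
  cases a.1.testBit k <;> cases a.2.testBit k <;> cases b.1.testBit k <;> cases b.2.testBit k <;> decide

/-- `smul2 c` multiplies by the constant `c`. [folklore] -/
theorem val2_smul2 (k c : ℕ) (a : S2) : val2 k (smul2 c a) = (c : ZMod 4) * val2 k a := by
  have hc : (c : ZMod 4) = ((c % 4 : ℕ) : ZMod 4) := (ZMod.natCast_mod c 4).symm
  rw [hc]
  unfold smul2
  obtain hr | hr | hr | hr : c % 4 = 0 ∨ c % 4 = 1 ∨ c % 4 = 2 ∨ c % 4 = 3 := by omega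
  · rw [hr]; norm_num
  · rw [hr]; norm_num
  · rw [hr]; norm_num
    unfold val2 bv
    dsimp only
    rw [Nat.zero_testBit]
    cases a.1.testBit k <;> cases a.2.testBit k <;> decide
  · rw [hr]; norm_num
    rw [val2_neg2]
    unfold val2 bv
    cases a.1.testBit k <;> cases a.2.testBit k <;> decide

/-- The constant digit `1` (slice `2^L − 1`) below `L`. [folklore] -/
theorem val2_ones {k L : ℕ} (hk : k < L) : val2 k (onesOf L, 0) = 1 := by
  unfold val2 bv onesOf
  rw [Nat.testBit_two_pow_sub_one]
  simp [hk]

/-- The constant digit `2` below `L`. [folklore] -/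
theorem val2_ones_hi {k L : ℕ} (hk : k < L) : val2 k (0, onesOf L) = 2 := by
  unfold val2 bv onesOf
  rw [Nat.testBit_two_pow_sub_one]
  simp [hk]

/-- The constant digit `3 = −1` below `L`. [folklore] -/
theorem val2_ones_both {k L : ℕ} (hk : k < L) : val2 k (onesOf L, onesOf L) = -1 := by
  unfold val2 bv onesOf
  rw [Nat.testBit_two_pow_sub_one]
  simp [hk]
  decide

/-- A natural number cast to `ZMod 4` is read off its two low bits. [folklore] -/
theorem natCast_eq_bits (n : ℕ) :
    (n : ZMod 4) = (if n.testBit 0 then 1 else 0) + 2 * (if n.testBit 1 then 1 else 0) := by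
  rw [← ZMod.natCast_mod n 4, Nat.testBit_succ, Nat.testBit_zero, Nat.testBit_zero,
    show n % 2 = n % 4 % 2 by omega, show n / 2 % 2 = n % 4 / 2 by omega]
  have h4 : n % 4 < 4 := Nat.mod_lt _ (by norm_num)
  generalize n % 4 = r at h4 ⊢
  interval_cases r <;> decide

/-- `ZMod.val` of a sliced digit. [folklore] -/
theorem val_val2 (k : ℕ) (a : S2) : (val2 k a).val = (a.1.testBit k).toNat + 2 * (a.2.testBit k).toNat := by
  unfold val2 bv
  cases a.1.testBit k <;> cases a.2.testBit k <;> decide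

/-! ## Vectors -/

section Inner

variable {p : ℕ}

/-- The inner sum of `conv2`. [folklore] -/
theorem val2_convSum (k : ℕ) (f g : List S2) (t : ℕ) :
    ∀ n, val2 k (convSum p f g t n) = ∑ a ∈ range n, val2 k (vget f a) * val2 k (vget g ((t + p - a) % p))
  | 0 => by simp [convSum]
  | n + 1 => by rw [convSum, val2_add2, val2_mul2, val2_convSum k f g t n, sum_range_succ]

/-- The inner sum of `vsumTo`. [folklore] -/
theorem val2_vsumTo (k : ℕ) (f : List S2) : ∀ n, val2 k (vsumTo f n) = ∑ t ∈ range n, val2 k (vget f t)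
  | 0 => by simp [vsumTo]
  | n + 1 => by rw [vsumTo, val2_add2, val2_vsumTo k f n, sum_range_succ]

/-- The inner sum of `psl`. [folklore] -/
theorem val2_pslSum (k : ℕ) (W : List ℕ) (X : List S2) (t : ℕ) : ∀ n, val2 k (pslSum p W X t n) =
    ∑ v ∈ range n, (W.getD v 0 : ZMod 4) * (val2 k (vget X ((t + v) % p)) + val2 k (vget X ((v + p - t) % p)))
  | 0 => by simp [pslSum]
  | n + 1 => by rw [pslSum, val2_add2, val2_smul2, val2_add2, val2_pslSum k W X t n, sum_range_succ]

/-- The inner sum of `qsl`. [folklore] -/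
theorem val2_qslSum (k : ℕ) (W : List ℕ) (X : List S2) (t : ℕ) : ∀ n, val2 k (qslSum p W X t n) =
    ∑ v ∈ range n, (W.getD v 0 : ZMod 4) * val2 k (vget X ((t + p - v) % p))
  | 0 => by simp [qslSum]
  | n + 1 => by rw [qslSum, val2_add2, val2_smul2, val2_qslSum k W X t n, sum_range_succ]

end Inner

section Vec

variable {p : ℕ} [NeZero p]

/-- The `ℤ/4`-valued function on `ZMod p` carried by datum `k` of a sliced vector. [folklore] -/
def toF (p : ℕ) [NeZero p] (k : ℕ) (f : List S2) : ZMod p → ZMod 4 := fun v => val2 k (vget f v.val)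

/-- Summing over `ZMod p` is summing over `range p` (any additive commutative monoid). [folklore] -/
theorem sum_zmod_val' {M : Type*} [AddCommMonoid M] (g : ℕ → M) : ∑ v : ZMod p, g v.val = ∑ i ∈ range p, g i := by
  obtain ⟨n, hn⟩ : ∃ n, p = n + 1 := ⟨p - 1, (Nat.succ_pred_eq_of_pos (Nat.pos_of_ne_zero (NeZero.ne p))).symm⟩
  subst hn
  exact Fin.sum_univ_eq_sum_range (fun i => g i) (n + 1)

/-- Reading a `map` over `range`. [folklore] -/
theorem vget_range_map (g : ℕ → S2) {n t : ℕ} (ht : t < n) : vget ((List.range n).map g) t = g t := by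
  unfold vget; exact LineInv.getD_range_map g ht _

/-- `toF` of a `map` over `range p`. [folklore] -/
theorem toF_range_map (k : ℕ) (g : ℕ → S2) (v : ZMod p) : toF p k ((List.range p).map g) v = val2 k (g v.val) := by
  unfold toF; rw [vget_range_map g (ZMod.val_lt v)]

/-- Index bridge: `(t + a) % p = (t + a).val`. [folklore] -/
theorem idx_add (t a : ZMod p) : (t.val + a.val) % p = (t + a).val := (LineInv.val_add_eq t a).symm

/-- Index bridge: `(p − t) % p = (−t).val`. [folklore] -/
theorem idx_neg (t : ZMod p) : (p - t.val) % p = (-t).val := by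
  rw [← zero_sub, LineInv.val_sub_eq, ZMod.val_zero, zero_add]

/-- **`conv2` is the cyclic convolution** (slice-wise). [folklore] -/
theorem toF_conv2 (k : ℕ) (f g : List S2) : toF p k (conv2 p f g) = cconv (toF p k f) (toF p k g) := by
  funext v
  unfold conv2 cconv
  rw [toF_range_map, val2_convSum, ← sum_zmod_val' (fun a => val2 k (vget f a) * val2 k (vget g ((v.val + p - a) % p)))]
  refine sum_congr rfl fun a _ => ?_
  unfold toF; rw [← LineInv.val_sub_eq]

/-- `hatv` reflects. [folklore] -/
theorem toF_hatv (k : ℕ) (g : List S2) : toF p k (hatv p g) = fun v => toF p k g (-v) := by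
  funext v; unfold hatv; rw [toF_range_map]; unfold toF; rw [idx_neg]

/-- `vadd` adds. [folklore] -/
theorem toF_vadd (k : ℕ) (f g : List S2) : toF p k (vadd p f g) = fun v => toF p k f v + toF p k g v := by
  funext v; unfold vadd; rw [toF_range_map, val2_add2]; rfl

/-- `vsub` subtracts. [folklore] -/
theorem toF_vsub (k : ℕ) (f g : List S2) : toF p k (vsub p f g) = fun v => toF p k f v - toF p k g v := by
  funext v; unfold vsub; rw [toF_range_map, val2_sub2]; rfl

/-- `vneg` negates. [folklore] -/
theorem toF_vneg (k : ℕ) (f : List S2) : toF p k (vneg p f) = fun v => -toF p k f v := by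
  funext v; unfold vneg; rw [toF_range_map, val2_neg2]; rfl

/-- `ppl` adds the constant `1` (below `L`). [folklore] -/
theorem toF_ppl {k L : ℕ} (hk : k < L) (P : List S2) : toF p k (ppl p (onesOf L) P) = fun v => toF p k P v + 1 := by
  funext v; unfold ppl; rw [toF_range_map, val2_add2, val2_ones hk]; rfl

/-- `vsumTo f p` sums over `ZMod p`. [folklore] -/
theorem val2_vsumTo_eq (k : ℕ) (f : List S2) : val2 k (vsumTo f p) = ∑ t : ZMod p, toF p k f t := by
  rw [val2_vsumTo]; unfold toF; exact (sum_zmod_val' _).symm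

/-- **`psl` is the circulant symbol `P`** of `lineMat3 (vecFn W) F` when the sliced data carry `F mod 4`. [folklore] -/
theorem toF_psl (k : ℕ) (W : List ℕ) (X : List S2) (F : ZMod p → ℕ) (hX : ∀ v, toF p k X v = (F v : ZMod 4)) :
    toF p k (psl p W X) = psym (vecFn W) F := by
  funext t
  unfold psl psym vecFn
  rw [toF_range_map, val2_pslSum,
    ← sum_zmod_val' (fun v => (W.getD v 0 : ZMod 4) * (val2 k (vget X ((t.val + v) % p)) + val2 k (vget X ((v + p - t.val) % p))))]
  refine sum_congr rfl fun v _ => ?_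
  rw [idx_add, ← LineInv.val_sub_eq, ← hX, ← hX]; rfl

/-- **`qsl` is the Hankel symbol `Q`**. [folklore] -/
theorem toF_qsl (k : ℕ) (W : List ℕ) (X : List S2) (F : ZMod p → ℕ) (hX : ∀ v, toF p k X v = (F v : ZMod 4)) :
    toF p k (qsl p W X) = qsym (vecFn W) F := by
  funext t
  unfold qsl qsym vecFn
  rw [toF_range_map, val2_qslSum,
    ← sum_zmod_val' (fun v => (W.getD v 0 : ZMod 4) * val2 k (vget X ((t.val + p - v) % p)))]
  refine sum_congr rfl fun v _ => ?_
  rw [← LineInv.val_sub_eq, ← hX]; rfl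

/-- **`holeVec`** carries `c₀ + α'(v − s) + β'(v + s)`. [folklore] -/
theorem toF_holeVec (k : ℕ) (c0 : S2) (α' β' : List S2) {s : ℕ} (hs : s < p) :
    toF p k (holeVec p c0 α' β' s) = fun v => val2 k c0 + toF p k α' (v - (s : ZMod p)) + toF p k β' (v + (s : ZMod p)) := by
  funext v
  unfold holeVec
  rw [toF_range_map, val2_add2, val2_add2, add_assoc]
  unfold toF
  rw [LineInv.val_sub_eq, ← idx_add, ZMod.val_natCast_of_lt hs]

end Vec

end LineMod

end Summit.MatrixMultiplication.OmegaCensus
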